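import Literature.AnabelianGeometry.EtaleTheta.Discharge.Sec5ConstantsDictionaryAtBaseFieldHull
import Literature.AnabelianGeometry.EtaleTheta.Discharge.Sec5Lem58NodeAtThetaSettingYdd
import HarnessLib

/-!
# [EtTh] Lemma 5.8 (Conjugation by Constants) p.331 (PDF p.105) — the typed NODE FIRED at the base-field-theoretic hull of a theta setting
# (proof-only corollary of the `ConstantsDictionary` knit)

S. Mochizuki, *The étale theta function and its Frobenioid-theoretic manifestations*, Publ. RIMS **45** (2009) [MochizukiEtTh2009], Lemma 5.8
p.331 (PDF p.105): «write `(K^×)^{1/N} ⊆ O^×(B_N^birat)` for the subgroup of elements whose `N`-th power lies in the image of the natural inclusion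
`K^× → O^×(B_N^birat)`; `(O_K^×)^{1/N} := (K^×)^{1/N} ∩ O^×(B_N)`.  Then `(O_K^×)^{1/N}` is equal to the set of elements of `O^×(B_N)` that normalize the
subgroup `E_N ⊆ Aut_C(B_N)`.  In particular, we have a natural outer action of `(O_K^×)^{1/N}/μ_N(B_N) ⥲ O_K^×` on `E_N`; this outer action extends to
an outer action of `(K^×)^{1/N}/μ_N(B_N) ⥲ K^×` on `E_N`.»  [cite: MochizukiEtTh2009, Lem 5.8 p.331 (PDF p.105)]

abc-iut cell, layer L2 = [EtTh], seat abc-iut-f-142 (gen 11); row (β1) «DICTIONARY KNIT (d) AT THE HULL», follow-up to FILE 2 ★ p545647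
(`Discharge/Sec5ConstantsDictionaryAtBaseFieldHull.lean`; abc-iut-L2-lead R1540 (4) / R1552 CLASS-CHECK).  PROOF-ONLY (class (a): 0 `def` / 0 instance /
0 notation / 0 `Prop`-valued definition / 0 sorry; nothing landed is edited or restated): abc-iut-L2-t4's BY-NAME node closer
`lem58_node_ofThetaSettingYdd_of_constantsDictionary` (`Discharge/Sec5Lem58NodeAtThetaSettingYdd.lean`, p490511; residual EXACTLY {junction data, `hconst`,
`m`, `hD`}) INSTANTIATED at the ONE carrier where the tree constructs its three non-structural inputs: the §5 data `ofThetaSettingData` of the Setting over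
abc-iut-L2-d3's base-field-theoretic hull `BsFldHull.temperedFrobenioid p C.augHuu …` with `A_⊙^bs := Ÿ̲̲` (`BiKummerSetting.mkOfThetaSettingYdd` = `hullSetting`,
`hullSetting_eq`), `K := D.K`, «the natural inclusion `K^× → O^×(B_N^birat)`» := `BsFldHull.constEmb` — with `hconst := BsFldHull.biratAutModel_constEmb`
(p506755, a THEOREM), `m := BsFldHull.muReadingEquiv` (FILE 1 ★ p530309) and `hD := constantsDictionary_hull` (FILE 2 ★ p545647).
* **`ThetaFrobenioid.lem58_node_hull`** — the five typed sub-rows of the node at the hull: `ConstantsEqNormalizer` (F-0536, the main assertion) ∧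
  `ConstantsActByCyclotome` (F-0535) ∧ `InvariantUnitsEqConstants` (L58-A3) ∧ `KxOuterActionExtends` (L58-B1) ∧ `KxRootNModCyclotome` (F-0538, L58-B2),
  residual ∀-binders EXACTLY {junction data of the hull (`Rq Sq NH pullFrac θ Bl Pl Rl Rt Q hinvc hinvp`; Setting side `e μ hC hS`), `K₀ ⊇ K` (`hK₀`),
  `hsat` := the Def. 5.4 fixing slot at `B_N` (`a(U_{B_N}) ≤ Gal(ℚ̄_p/E_N(K₀))`, p527685)} — NO `hconst`, NO `m`, NO `hD`.  `set_option maxHeartbeats 800000`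
  on this one declaration (the mixed `Γ`-typing `↥C.Huu` / `(C.temperedArithmeticGroup e).Pi` of the hull-of-the-Setting statements, FILE 2's note).
HONEST FRAMING: the carrier has GENUINE base `B^temp(Π^tp_X̲̲)⁰`, genuine constants `K ⊆ ℚ̄_p` and genuine Galois action but DEGENERATE divisor geometry
(every rational function is a constant; abc-iut-L2-d3's label) — a discharge of the node's displayed inputs {`hconst`, `m`, `hD`} AT THIS CARRIER modulo the
slot `hsat`, NOT [EtTh] Lemma 5.8 for the tempered Frobenioid of a Tate curve (which enters the tree only as the abstract parameter `tf`); at abc-iut-L2-t9's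
`temperedFrobenioidSmall` no such dictionary exists (p499346).  Nothing of [EtTh] (a refereed paper) is asserted unconditionally; typed ≠ proved;
discharged-at-our-data ≠ endorsed; nothing here bears on [IUTchIII] Cor. 3.12; no side taken.
-/

noncomputable section

namespace Literature.AnabelianGeometry.EtaleTheta

open CategoryTheory Opposite Literature.AlgebraicGeometry.Frobenioids Literature.AnabelianGeometry.SemiGraphs
  Literature.AnabelianGeometry.SemiGraphs.GaloisObjects Literature.AlgebraicGeometry.Frobenioids.QuasiTemperoid.BTempConnected

namespace ThetaFrobenioid

section HullNode

variable {p : ℕ} [Fact p.Prime] {D : ThetaSetting p} {E : D.EtaleThetaData} {l : ℕ} {C : E.DoubleUnderline l}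
  {e : D.toTemperedCurve.GroupLevelData} {N : ℕ+} (μ : D.CyclotomeMod l N) (hC : D.Compat) (hS : D.Sec2Hyps)
  {Rq Sq : ((ConnectedPart (BTemp (C.temperedArithmeticGroup e).Pi))ᵒᵖ ⥤ CommMonCat.{0}) → Prop}
  {NH : Subgroup (Field.absoluteGaloisGroup D.K) → (BsFldHull.temperedFrobenioid p C.augHuu (C.isOpen_map_augHuu e) (C.temperedArithmeticGroup e).isTempered Rq Sq).category → ℕ+ → Prop}
  {pullFrac : ∀ {A A' : (BiKummerSetting.mkOfThetaSettingYdd C e μ hC hS (BsFldHull.temperedFrobenioid p C.augHuu (C.isOpen_map_augHuu e) (C.temperedArithmeticGroup e).isTempered Rq Sq) (BsFldHull.temperedFrobenioid_monoidType p C.augHuu (C.isOpen_map_augHuu e) (C.temperedArithmeticGroup e).isTempered Rq Sq) (BsFldHull.hP p C.augHuu (C.isOpen_map_augHuu e) (C.temperedArithmeticGroup e).isTempered Rq Sq) NH).C} (_ : A' ⟶ A), (BiKummerSetting.mkOfThetaSettingYdd C e μ hC hS (BsFldHull.temperedFrobenioid p C.augHuu (C.isOpen_map_augHuu e) (C.temperedArithmeticGroup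 e).isTempered Rq Sq) (BsFldHull.temperedFrobenioid_monoidType p C.augHuu (C.isOpen_map_augHuu e) (C.temperedArithmeticGroup e).isTempered Rq Sq) (BsFldHull.hP p C.augHuu (C.isOpen_map_augHuu e) (C.temperedArithmeticGroup e).isTempered Rq Sq) NH).biratUnits A → (BiKummerSetting.mkOfThetaSettingYdd C e μ hC hS (BsFldHull.temperedFrobenioid p C.augHuu (C.isOpen_map_augHuu e) (C.temperedArithmeticGroup e).isTempered Rq Sq) (BsFldHull.temperedFrobenioid_monoidType p C.augHuu (C.isOpen_map_augHuu e) (C.temperedArithmeticGroup e).isTempered Rq Sq) (BsFldHull.hP p C.augHuu (C.isOpen_map_augHuu e) (C.temperedArithmeticGroup e).isTempered Rq Sq) NH).biratUnits A'}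
  {θ : (BiKummerSetting.mkOfThetaSettingYdd C e μ hC hS (BsFldHull.temperedFrobenioid p C.augHuu (C.isOpen_map_augHuu e) (C.temperedArithmeticGroup e).isTempered Rq Sq) (BsFldHull.temperedFrobenioid_monoidType p C.augHuu (C.isOpen_map_augHuu e) (C.temperedArithmeticGroup e).isTempered Rq Sq) (BsFldHull.hP p C.augHuu (C.isOpen_map_augHuu e) (C.temperedArithmeticGroup e).isTempered Rq Sq) NH).biratUnits (BiKummerSetting.mkOfThetaSettingYdd C e μ hC hS (BsFldHull.temperedFrobenioid p C.augHuu (C.isOpen_map_augHuu e) (C.temperedArithmeticGroup e).isTempered Rq Sq) (BsFldHull.temperedFrobenioid_monoidType p C.augHuu (C.isOpen_map_augHuu e) (C.temperedArithmeticGroup e).isTempered Rq Sq) (BsFldHull.hP p C.augHuu (C.isOpen_map_augHuu e) (C.temperedArithmeticGroup e).isTempered Rq Sq) NH).Aodot}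
  {Bl : (BiKummerSetting.mkOfThetaSettingYdd C e μ hC hS (BsFldHull.temperedFrobenioid p C.augHuu (C.isOpen_map_augHuu e) (C.temperedArithmeticGroup e).isTempered Rq Sq) (BsFldHull.temperedFrobenioid_monoidType p C.augHuu (C.isOpen_map_augHuu e) (C.temperedArithmeticGroup e).isTempered Rq Sq) (BsFldHull.hP p C.augHuu (C.isOpen_map_augHuu e) (C.temperedArithmeticGroup e).isTempered Rq Sq) NH).C}
  {Pl : (BiKummerSetting.mkOfThetaSettingYdd C e μ hC hS (BsFldHull.temperedFrobenioid p C.augHuu (C.isOpen_map_augHuu e) (C.temperedArithmeticGroup e).isTempered Rq Sq) (BsFldHull.temperedFrobenioid_monoidType p C.augHuu (C.isOpen_map_augHuu e) (C.temperedArithmeticGroup e).isTempered Rq Sq) (BsFldHull.hP p C.augHuu (C.isOpen_map_augHuu e) (C.temperedArithmeticGroup e).isTempered Rq Sq) NH).FractionPair θ Bl}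
  {Rl : (BiKummerSetting.mkOfThetaSettingYdd C e μ hC hS (BsFldHull.temperedFrobenioid p C.augHuu (C.isOpen_map_augHuu e) (C.temperedArithmeticGroup e).isTempered Rq Sq) (BsFldHull.temperedFrobenioid_monoidType p C.augHuu (C.isOpen_map_augHuu e) (C.temperedArithmeticGroup e).isTempered Rq Sq) (BsFldHull.hP p C.augHuu (C.isOpen_map_augHuu e) (C.temperedArithmeticGroup e).isTempered Rq Sq) NH).NthRoot θ Pl C.lPNat pullFrac}
  (Q : FrobenioidTheta.ThetaSubquotientStub.{0} (ConnectedPart (BTemp (C.temperedArithmeticGroup e).Pi)))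
  (Rt : (BiKummerSetting.mkOfThetaSettingYdd C e μ hC hS (BsFldHull.temperedFrobenioid p C.augHuu (C.isOpen_map_augHuu e) (C.temperedArithmeticGroup e).isTempered Rq Sq) (BsFldHull.temperedFrobenioid_monoidType p C.augHuu (C.isOpen_map_augHuu e) (C.temperedArithmeticGroup e).isTempered Rq Sq) (BsFldHull.hP p C.augHuu (C.isOpen_map_augHuu e) (C.temperedArithmeticGroup e).isTempered Rq Sq) NH).NthRoot Rl.root Rl.pair N pullFrac)
  (hinvc : ∀ g : Aut Rt.AN.base,
    pull (BsFldHull.temperedFrobenioid p C.augHuu (C.isOpen_map_augHuu e) (C.temperedArithmeticGroup e).isTempered Rq Sq).divisorMonoid g.hom (ModelFrobenioid.div Rt.pair.num) = ModelFrobenioid.div Rt.pair.num)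
  (hinvp : ∀ y : (C.thetaEnvData μ hC hS).PiX, y ∈ (C.thetaEnvData μ hC hS).PiYdd →
    pull (BsFldHull.temperedFrobenioid p C.augHuu (C.isOpen_map_augHuu e) (C.temperedArithmeticGroup e).isTempered Rq Sq).divisorMonoid ((BiKummerSetting.mkOfThetaSettingYdd C e μ hC hS (BsFldHull.temperedFrobenioid p C.augHuu (C.isOpen_map_augHuu e) (C.temperedArithmeticGroup e).isTempered Rq Sq) (BsFldHull.temperedFrobenioid_monoidType p C.augHuu (C.isOpen_map_augHuu e) (C.temperedArithmeticGroup e).isTempered Rq Sq) (BsFldHull.hP p C.augHuu (C.isOpen_map_augHuu e) (C.temperedArithmeticGroup e).isTempered Rq Sq) NH).galoisSurj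
      Rt.AN.base Rt.αData.isGalois ((ContinuousMulEquiv.refl _) y)).hom (ModelFrobenioid.div Rt.pair.den) = ModelFrobenioid.div Rt.pair.den)
  (K₀ : IntermediateField ℚ_[p] (PadicAlgCl p)) (hK₀ : D.K ≤ K₀)
  (hsat : (((CosetCat.equivConnectedPart (C.temperedArithmeticGroup e).isTempered).inverse.obj Rt.BN.base).sg.toSubgroup.map C.augHuu :
      Subgroup (GQp p)) ≤
    (IntermediateField.normalClosure ℚ_[p]
      (IntermediateField.adjoin ℚ_[p] ((K₀ : Set (PadicAlgCl p)) ∪ {x | x ^ (N : ℕ) ∈ K₀})) (PadicAlgCl p)).fixingSubgroup)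

include hK₀ hsat in
set_option maxHeartbeats 800000 in
/-- **[EtTh] Lemma 5.8 — the typed NODE at the base-field-theoretic hull of the Setting**, residual EXACTLY {junction data, `K₀ ⊇ K`, the Def. 5.4 slot
`hsat`}: `ConstantsEqNormalizer ∧ ConstantsActByCyclotome ∧ InvariantUnitsEqConstants ∧ KxOuterActionExtends ∧ KxRootNModCyclotome` for the §5 data
`ofThetaSettingData μ hC hS …` over `mkOfThetaSettingYdd C e μ hC hS (BsFldHull.temperedFrobenioid p C.augHuu …) …` with `K := D.K`,
`constEmb := BsFldHull.constEmb` — abc-iut-L2-t4's `lem58_node_ofThetaSettingYdd_of_constantsDictionary` (p490511) with its three non-structural inputs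
SUPPLIED BY NAME: `hconst := BsFldHull.biratAutModel_constEmb` (p506755), `m := BsFldHull.muReadingEquiv` (p530309), `hD := constantsDictionary_hull`
(p545647).  HONEST: degenerate divisor geometry at this carrier; a discharge at OUR carrier, not print's tempered Frobenioid of a curve; no side taken on
[IUTchIII] Cor. 3.12; typed ≠ proved.  [cite: MochizukiEtTh2009, Lem 5.8 p.331 (PDF p.105); Def 5.4 p.327 (PDF p.101)] -/
theorem lem58_node_hull :
    (ofThetaSettingData μ hC hS (BsFldHull.hypotheses p C.augHuu (C.isOpen_map_augHuu e) (C.temperedArithmeticGroup e).isTempered Rq Sq) Q Rt (D.K)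
        (BsFldHull.constEmb p C.augHuu (C.isOpen_map_augHuu e) D.K augHuu_mem_fixingSubgroup (C.temperedArithmeticGroup e).isTempered Rq Sq Rt.BN)
        (BsFldHull.constEmb_injective p C.augHuu (C.isOpen_map_augHuu e) D.K augHuu_mem_fixingSubgroup (C.temperedArithmeticGroup e).isTempered Rq Sq Rt.BN)
        hinvc hinvp).ConstantsEqNormalizer ∧
    (ofThetaSettingData μ hC hS (BsFldHull.hypotheses p C.augHuu (C.isOpen_map_augHuu e) (C.temperedArithmeticGroup e).isTempered Rq Sq) Q Rt (D.K)
        (BsFldHull.constEmb p C.augHuu (C.isOpen_map_augHuu e) D.K augHuu_mem_fixingSubgroup (C.temperedArithmeticGroup e).isTempered Rq Sq Rt.BN)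
        (BsFldHull.constEmb_injective p C.augHuu (C.isOpen_map_augHuu e) D.K augHuu_mem_fixingSubgroup (C.temperedArithmeticGroup e).isTempered Rq Sq Rt.BN)
        hinvc hinvp).ConstantsActByCyclotome ∧
    (ofThetaSettingData μ hC hS (BsFldHull.hypotheses p C.augHuu (C.isOpen_map_augHuu e) (C.temperedArithmeticGroup e).isTempered Rq Sq) Q Rt (D.K)
        (BsFldHull.constEmb p C.augHuu (C.isOpen_map_augHuu e) D.K augHuu_mem_fixingSubgroup (C.temperedArithmeticGroup e).isTempered Rq Sq Rt.BN)
        (BsFldHull.constEmb_injective p C.augHuu (C.isOpen_map_augHuu e) D.K augHuu_mem_fixingSubgroup (C.temperedArithmeticGroup e).isTempered Rq Sq Rt.BN)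
        hinvc hinvp).InvariantUnitsEqConstants ∧
    (ofThetaSettingData μ hC hS (BsFldHull.hypotheses p C.augHuu (C.isOpen_map_augHuu e) (C.temperedArithmeticGroup e).isTempered Rq Sq) Q Rt (D.K)
        (BsFldHull.constEmb p C.augHuu (C.isOpen_map_augHuu e) D.K augHuu_mem_fixingSubgroup (C.temperedArithmeticGroup e).isTempered Rq Sq Rt.BN)
        (BsFldHull.constEmb_injective p C.augHuu (C.isOpen_map_augHuu e) D.K augHuu_mem_fixingSubgroup (C.temperedArithmeticGroup e).isTempered Rq Sq Rt.BN)
        hinvc hinvp).KxOuterActionExtends ∧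
    (ofThetaSettingData μ hC hS (BsFldHull.hypotheses p C.augHuu (C.isOpen_map_augHuu e) (C.temperedArithmeticGroup e).isTempered Rq Sq) Q Rt (D.K)
        (BsFldHull.constEmb p C.augHuu (C.isOpen_map_augHuu e) D.K augHuu_mem_fixingSubgroup (C.temperedArithmeticGroup e).isTempered Rq Sq Rt.BN)
        (BsFldHull.constEmb_injective p C.augHuu (C.isOpen_map_augHuu e) D.K augHuu_mem_fixingSubgroup (C.temperedArithmeticGroup e).isTempered Rq Sq Rt.BN)
        hinvc hinvp).KxRootNModCyclotome :=
  lem58_node_ofThetaSettingYdd_of_constantsDictionary μ hC hS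
    (BsFldHull.hypotheses p C.augHuu (C.isOpen_map_augHuu e) (C.temperedArithmeticGroup e).isTempered Rq Sq) Q Rt (D.K)
    (BsFldHull.constEmb p C.augHuu (C.isOpen_map_augHuu e) D.K augHuu_mem_fixingSubgroup (C.temperedArithmeticGroup e).isTempered Rq Sq Rt.BN)
    (BsFldHull.constEmb_injective p C.augHuu (C.isOpen_map_augHuu e) D.K augHuu_mem_fixingSubgroup (C.temperedArithmeticGroup e).isTempered Rq Sq Rt.BN)
    hinvc hinvp
    (BsFldHull.biratAutModel_constEmb p C.augHuu (C.isOpen_map_augHuu e) D.K augHuu_mem_fixingSubgroup (C.temperedArithmeticGroup e).isTempered Rq Sq Rt.BN)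
    (BsFldHull.muReadingEquiv (T := C.thetaEnvData μ hC hS) p Rt (BsFldHull.hypotheses p C.augHuu (C.isOpen_map_augHuu e) (C.temperedArithmeticGroup e).isTempered Rq Sq) Q C.odd_lPNat (ContinuousMulEquiv.refl _) (D.K)
      (BsFldHull.constEmb p C.augHuu (C.isOpen_map_augHuu e) D.K augHuu_mem_fixingSubgroup (C.temperedArithmeticGroup e).isTempered Rq Sq Rt.BN)
      (BsFldHull.constEmb_injective p C.augHuu (C.isOpen_map_augHuu e) D.K augHuu_mem_fixingSubgroup (C.temperedArithmeticGroup e).isTempered Rq Sq Rt.BN)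
      hinvc hinvp (hμN_of_fixingSlot Rt K₀ hsat))
    (constantsDictionary_hull μ hC hS Q Rt hinvc hinvp K₀ hK₀ hsat)

end HullNode

end ThetaFrobenioid

end Literature.AnabelianGeometry.EtaleTheta

end
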